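/-
Copyright (c) 2026 the pub-hodgecm-mathlib formalisation cell (harness21).  Prover seat hodgecm-mathlib-K2E3-p11 (g10), Track B «K2-LIT», #184♮ = hLiu418 =
`stmt-HodgeConjecture-24832`; socket #41, KIND W, (KW-arch-hBL) brick (3d-iv) §A — KW desk F0P2-p08 (g4) RULING 2026-09-05T01:46:55Z «= K2E3-p11 pens (3d-iv)
`K2LiuKindWArchGrowthStabUniform :: stabUniform_of_atOne` (§A generic section∕picture algebra + family merge, §B head)».  THEOREMS ONLY (no `def`, no `instance`,
no notation, no named-fact hypothesis, no `sorry`).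
-/
import Summits.HodgeConjecture.HodgeConjecture.Theorems.K2LiuKindWArchGrowthFaceOfRecord      -- ★ p864208 (this seat): `face_mono`, `inv_one_add_sum_le`, `le_sum_univ` + the KW-arch alphabet
import Summits.HodgeConjecture.HodgeConjecture.Theorems.K2LiuKindWArchIwasawaComparability     -- ★ p864102 (this seat): `norm_apply_le_one_of_stab`, `entrySum_mul_mul_le` (+ ★ `mem_unitaryGroup_of_stab`)
import Mathlib.RingTheory.MvPolynomial.Basic                                                   -- `restrictTotalDegree` (finite-dimensional)
import Mathlib.Algebra.MvPolynomial.Monad                                                      -- `bind₁`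
import Mathlib.Topology.Algebra.MvPolynomial                                                   -- `MvPolynomial.continuous_eval`
import HarnessLib

/-!
# Crux `HLiu418`, socket #41, KIND W — `K2LiuKindWArchStabPictures`: (3d-iv) §A, the stabiliser pictures of archimedean Siegel sections

Cell `hodgecm-mathlib`, crux item hLiu418 = `stmt-HodgeConjecture-24832` (helper lane `--supports … --as helper`, count-neutral).  (KW-arch-hBL) brick (3d-iv)
«Stab-UNIFORMIZATION» (architect finding 2026-09-05T01:46:10Z, desk «=» 01:46:55Z): between the AT-ONE growth letters (★ `K2LiuKindWArchWhittakerGrowthAtOnePic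
.exists_growth_constants_of_posDef_pic` and its negdef ∕ indefinite twins — constants uniform on the Siegel-form locus `diag(C,−B)·g = n(X₀)·diag(R,R⁻¹)`) and the
(ii″) `u₀`-FACE letters `hPosU ∕ hNegU ∕ hIndU` of ★ `K2LiuKindWArchGrowthFaceOfRecord.hWgrU_of_record` sits the uniformity over the compact stabiliser
`K = U(J) ∩ Stab(i1)`.  This file is the GENERIC half (§B `K2LiuKindWArchGrowthStabUniform` is the head):
* §1 the section space `I_w(s, χ)` (tube frame, ★ `IsArchSiegelSection`): finite sums of right translates of a section are sections (the parabolic law is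
  left-sided); that two sections with the same `K`-picture agree on `U(J)` is ★ `K2LiuArchPMinusCarrier.eq_of_isArchSiegelSection_of_eqOn_stab` (used in §B);
* §2 the stabiliser `K`: closed under products, `1 ∈ K`, `uᴴ = u⁻¹ ∈ K`, and `K` is COMPACT (closed by ★ `moeb_I_eq_I_iff`, bounded by ★ `norm_apply_le_one_of_stab`);
* §3 polynomial `K`-pictures: right translation by `k₀` acts on a polynomial picture `P` (variables = entries of `u` and their conjugates, ★ JUNCTION's alphabet) by
  the substitution `bind₁` of LINEAR forms, `eval_u (bind₁ (σ k₀) P) = eval_{u·k₀} P`, which does not raise `totalDegree` — so all translates of one picture live in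
  the finite-dimensional image of `restrictTotalDegree`, and depend continuously on `k₀`;
* §4 unitary bookkeeping for the Levi ambiguity `R ↦ R′κ` of ★ `levi_letters_unique` (`‖det κ‖ = 1`, `T₂(κᴴ M κ) ≤ 4·T₂(M)`, `‖det(κᴴ M κ)‖ = ‖det M‖`);
* §5 the FAMILY MERGE `exists_uniform_of_finite_family`: finitely many parameter-dependent continued letters `EwG i p`, each with (ii″)-shaped growth uniform in
  the admissible parameters `p`, and coefficient vectors of `ℓ¹`-norm `≤ Ma` ⟹ ONE set of constants for every `Σ_i a_i · EwG i p` (= ★ K2E4-p10's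
  `growth_uniform_of_finite_span` with the parameter threaded through the letters and the linear relation definitional; constants merged by ★ `face_mono`).
References: [Shimura1997] §16.4, §18.4 (Siegel sections, the compact picture, uniform estimates); [KudlaRallis1994] §1; [BorelJacquet1979] §4.1.
HONEST LABEL.  Count-neutral helper; `HC_CM` is proved only modulo the 7 printed citations (2 remaining named inputs: hLiu418 = `stmt-HodgeConjecture-24832`,
h413 = `stmt-HodgeConjecture-24833`) until rung 0 closes.
-/

set_option autoImplicit false
set_option linter.dupNamespace false -- the mandated namespace repeats `HodgeConjecture.HodgeConjecture`

noncomputable section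

open Complex Matrix
open scoped ComplexConjugate ComplexOrder

namespace Summit.HodgeConjecture.HodgeConjecture.Cruxes.HLiu418.K2LiuKindWArchStabPictures

open Literature.NumberTheory.ModularForms.SiegelUpperHalfSpace (moeb moeb_one)
open Summit.HodgeConjecture.HodgeConjecture.Cruxes.HLiu418.K2LiuArchInducedTubeDefs
open Summit.HodgeConjecture.HodgeConjecture.Cruxes.HLiu418.K2LiuHermitianTubeCocycle (mul_mem_UJ moeb_mul_of_posDef posDef_im_I_smul_one)
open Summit.HodgeConjecture.HodgeConjecture.Cruxes.HLiu418.K2LiuHermitianTubeAction (moeb_I_eq_I_iff)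
open Summit.HodgeConjecture.HodgeConjecture.Cruxes.HLiu418.K2LiuSiegelStabBlocks (mem_unitaryGroup_of_stab)
open Summit.HodgeConjecture.HodgeConjecture.Cruxes.HLiu418.K2LiuKindWArchIwasawaComparability (norm_apply_le_one_of_stab entrySum_mul_mul_le)
open Summit.HodgeConjecture.HodgeConjecture.Cruxes.HLiu418.K2LiuKindWArchGrowthFaceOfRecord (face_mono inv_one_add_sum_le le_sum_univ)

/-! ## §1 The section space: finite sums of right translates -/

section SectionSpace

variable {l : Type*} [Fintype l] [DecidableEq l]

/-- a finite linear combination of RIGHT TRANSLATES of a Siegel section is a Siegel section (the parabolic law is left-sided). [cite: Shimura1997, §16.4] -/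
theorem isArchSiegelSection_sum_mul_rightTranslate {ι : Type*} (S : Finset ι) {χ : ℂ → ℂ} {s : ℂ} {F : Matrix (l ⊕ l) (l ⊕ l) ℂ → ℂ}
    (hF : IsArchSiegelSection χ s F) (c : ι → ℂ) (κ : ι → Matrix (l ⊕ l) (l ⊕ l) ℂ) :
    IsArchSiegelSection χ s (fun g => ∑ j ∈ S, c j * F (g * κ j)) := by
  intro p g hp hp21
  have h : ∀ j ∈ S, c j * F (p * g * κ j) =
      χ p.toBlocks₁₁.det * (((‖p.toBlocks₁₁.det‖ : ℝ) : ℂ) ^ (2 * s + (Fintype.card l : ℂ))) * (c j * F (g * κ j)) := fun j _ => by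
    rw [Matrix.mul_assoc, hF p (g * κ j) hp hp21]; ring
  simp only
  rw [Finset.sum_congr rfl h, ← Finset.mul_sum]

end SectionSpace

/-! ## §2 The stabiliser `K = U(J) ∩ Stab(i1)` -/

section Stabiliser

variable {l : Type*} [Fintype l] [DecidableEq l]

/-- `K` is closed under products. [cite: Shimura1997, §6.5] -/
theorem stab_mul {u v : Matrix (l ⊕ l) (l ⊕ l) ℂ} (hu : uᴴ * Matrix.J l ℂ * u = Matrix.J l ℂ) (huI : moeb u (I • (1 : Matrix l l ℂ)) = I • 1)
    (hv : vᴴ * Matrix.J l ℂ * v = Matrix.J l ℂ) (hvI : moeb v (I • (1 : Matrix l l ℂ)) = I • 1) :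
    (u * v)ᴴ * Matrix.J l ℂ * (u * v) = Matrix.J l ℂ ∧ moeb (u * v) (I • (1 : Matrix l l ℂ)) = I • 1 :=
  ⟨mul_mem_UJ hu hv, by rw [moeb_mul_of_posDef hv posDef_im_I_smul_one, hvI, huI]⟩

/-- `1 ∈ K`. [folklore] -/
theorem stab_one : (1 : Matrix (l ⊕ l) (l ⊕ l) ℂ)ᴴ * Matrix.J l ℂ * 1 = Matrix.J l ℂ ∧ moeb (1 : Matrix (l ⊕ l) (l ⊕ l) ℂ) (I • (1 : Matrix l l ℂ)) = I • 1 :=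
  ⟨by rw [conjTranspose_one, Matrix.one_mul, Matrix.mul_one], moeb_one _⟩

/-- an element of `K` is unitary: `u·uᴴ = 1` (★ `mem_unitaryGroup_of_stab`). [cite: Shimura1997, §6.5] -/
theorem mul_conjTranspose_of_stab {u : Matrix (l ⊕ l) (l ⊕ l) ℂ} (hu : uᴴ * Matrix.J l ℂ * u = Matrix.J l ℂ) (huI : moeb u (I • (1 : Matrix l l ℂ)) = I • 1) :
    u * uᴴ = 1 := by
  have h := Matrix.mem_unitaryGroup_iff.1 (mem_unitaryGroup_of_stab hu huI)
  rwa [star_eq_conjTranspose] at h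

/-- an element of `K` is unitary: `uᴴ·u = 1`. [cite: Shimura1997, §6.5] -/
theorem conjTranspose_mul_of_stab {u : Matrix (l ⊕ l) (l ⊕ l) ℂ} (hu : uᴴ * Matrix.J l ℂ * u = Matrix.J l ℂ) (huI : moeb u (I • (1 : Matrix l l ℂ)) = I • 1) :
    uᴴ * u = 1 := by
  have h := Matrix.mem_unitaryGroup_iff'.1 (mem_unitaryGroup_of_stab hu huI)
  rwa [star_eq_conjTranspose] at h

/-- `K` is closed under `u ↦ uᴴ = u⁻¹`. [cite: Shimura1997, §6.5] -/
theorem stab_conjTranspose {u : Matrix (l ⊕ l) (l ⊕ l) ℂ} (hu : uᴴ * Matrix.J l ℂ * u = Matrix.J l ℂ) (huI : moeb u (I • (1 : Matrix l l ℂ)) = I • 1) :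
    uᴴᴴ * Matrix.J l ℂ * uᴴ = Matrix.J l ℂ ∧ moeb uᴴ (I • (1 : Matrix l l ℂ)) = I • 1 := by
  have h1 := mul_conjTranspose_of_stab hu huI
  have hJ : uᴴᴴ * Matrix.J l ℂ * uᴴ = Matrix.J l ℂ := by
    rw [conjTranspose_conjTranspose]
    calc u * Matrix.J l ℂ * uᴴ = u * (uᴴ * Matrix.J l ℂ * u) * uᴴ := by rw [hu]
      _ = (u * uᴴ) * Matrix.J l ℂ * (u * uᴴ) := by simp only [Matrix.mul_assoc]
      _ = Matrix.J l ℂ := by rw [h1, Matrix.one_mul, Matrix.mul_one]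
  refine ⟨hJ, ?_⟩
  have h2 : moeb (uᴴ * u) (I • (1 : Matrix l l ℂ)) = I • 1 := by
    rw [conjTranspose_mul_of_stab hu huI, moeb_one]
  rwa [moeb_mul_of_posDef hu posDef_im_I_smul_one, huI] at h2

/-- **`K = U(J) ∩ Stab(i1)` IS COMPACT** (`n = 2`): closed — the stabiliser equation `iA + B = −C + iD` of ★ `moeb_I_eq_I_iff` is polynomial — and bounded —
entries `≤ 1` (★ `norm_apply_le_one_of_stab`). [cite: Shimura1997, §6.5] -/
theorem isCompact_stab :
    IsCompact {u : Matrix (Fin 2 ⊕ Fin 2) (Fin 2 ⊕ Fin 2) ℂ |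
      uᴴ * Matrix.J (Fin 2) ℂ * u = Matrix.J (Fin 2) ℂ ∧ moeb u (I • (1 : Matrix (Fin 2) (Fin 2) ℂ)) = I • 1} := by
  -- the polynomial description of the stabiliser
  have hset : {u : Matrix (Fin 2 ⊕ Fin 2) (Fin 2 ⊕ Fin 2) ℂ |
      uᴴ * Matrix.J (Fin 2) ℂ * u = Matrix.J (Fin 2) ℂ ∧ moeb u (I • (1 : Matrix (Fin 2) (Fin 2) ℂ)) = I • 1} =
      {u | uᴴ * Matrix.J (Fin 2) ℂ * u = Matrix.J (Fin 2) ℂ} ∩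
        {u | I • u.toBlocks₁₁ + u.toBlocks₁₂ = -u.toBlocks₂₁ + I • u.toBlocks₂₂} := by
    ext u
    simp only [Set.mem_setOf_eq, Set.mem_inter_iff]
    constructor
    · rintro ⟨hu, huI⟩; exact ⟨hu, (moeb_I_eq_I_iff hu).1 huI⟩
    · rintro ⟨hu, h⟩; exact ⟨hu, (moeb_I_eq_I_iff hu).2 h⟩
  -- closed
  have hb : ∀ (a b : Fin 2 → Fin 2 ⊕ Fin 2), Continuous fun u : Matrix (Fin 2 ⊕ Fin 2) (Fin 2 ⊕ Fin 2) ℂ => u.submatrix a b := fun a b =>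
    (continuous_id (X := Matrix (Fin 2 ⊕ Fin 2) (Fin 2 ⊕ Fin 2) ℂ)).matrix_submatrix a b
  have hclosed : IsClosed ({u : Matrix (Fin 2 ⊕ Fin 2) (Fin 2 ⊕ Fin 2) ℂ | uᴴ * Matrix.J (Fin 2) ℂ * u = Matrix.J (Fin 2) ℂ} ∩
      {u | I • u.toBlocks₁₁ + u.toBlocks₁₂ = -u.toBlocks₂₁ + I • u.toBlocks₂₂}) := by
    refine IsClosed.inter (isClosed_eq ((continuous_id.matrix_conjTranspose.matrix_mul continuous_const).matrix_mul continuous_id) continuous_const)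
      (isClosed_eq ?_ ?_)
    · exact ((hb Sum.inl Sum.inl).const_smul I).add (hb Sum.inl Sum.inr)
    · exact (hb Sum.inr Sum.inl).neg.add ((hb Sum.inr Sum.inr).const_smul I)
  -- bounded: inside the entry box, which is compact
  have hbox : IsCompact (Set.univ.pi fun _ : Fin 2 ⊕ Fin 2 => Set.univ.pi fun _ : Fin 2 ⊕ Fin 2 => Metric.closedBall (0 : ℂ) 1 :
      Set (Matrix (Fin 2 ⊕ Fin 2) (Fin 2 ⊕ Fin 2) ℂ)) :=
    isCompact_univ_pi fun _ => isCompact_univ_pi fun _ => isCompact_closedBall (0 : ℂ) 1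
  rw [hset]
  refine hbox.of_isClosed_subset hclosed ?_
  rintro u ⟨hu, h⟩
  refine Set.mem_univ_pi.2 fun i => Set.mem_univ_pi.2 fun j => ?_
  rw [Metric.mem_closedBall, dist_zero_right]
  exact norm_apply_le_one_of_stab hu ((moeb_I_eq_I_iff hu).2 h) i j

end Stabiliser

/-! ## §3 Polynomial `K`-pictures and their right translates -/

/-- **RIGHT TRANSLATION OF A POLYNOMIAL PICTURE IS A LINEAR SUBSTITUTION**: with the substitution `X_{(p,q)} ↦ Σ_r X_{(p,r)}·(k₀)_{rq}`, `X̄_{(p,q)} ↦ Σ_r X̄_{(p,r)}·conj (k₀)_{rq}`,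
`eval_u (bind₁ σ_{k₀} P) = eval_{u·k₀} P` (★ JUNCTION's variable alphabet: entries of `u` then their conjugates). [folklore] [cite: Shimura1997, §16.4] -/
theorem eval_bind₁_translate (P : MvPolynomial (((Fin 2 ⊕ Fin 2) × (Fin 2 ⊕ Fin 2)) ⊕ ((Fin 2 ⊕ Fin 2) × (Fin 2 ⊕ Fin 2))) ℂ)
    (u k₀ : Matrix (Fin 2 ⊕ Fin 2) (Fin 2 ⊕ Fin 2) ℂ) :
    MvPolynomial.eval (Sum.elim (fun pq : (Fin 2 ⊕ Fin 2) × (Fin 2 ⊕ Fin 2) => u pq.1 pq.2) (fun pq : (Fin 2 ⊕ Fin 2) × (Fin 2 ⊕ Fin 2) => conj (u pq.1 pq.2)))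
        (MvPolynomial.bind₁
          (Sum.elim (fun pq : (Fin 2 ⊕ Fin 2) × (Fin 2 ⊕ Fin 2) => ∑ r, MvPolynomial.X (Sum.inl (pq.1, r)) * MvPolynomial.C (k₀ r pq.2))
            (fun pq : (Fin 2 ⊕ Fin 2) × (Fin 2 ⊕ Fin 2) => ∑ r, MvPolynomial.X (Sum.inr (pq.1, r)) * MvPolynomial.C (conj (k₀ r pq.2)))) P) =
      MvPolynomial.eval (Sum.elim (fun pq : (Fin 2 ⊕ Fin 2) × (Fin 2 ⊕ Fin 2) => (u * k₀) pq.1 pq.2) (fun pq : (Fin 2 ⊕ Fin 2) × (Fin 2 ⊕ Fin 2) => conj ((u * k₀) pq.1 pq.2))) P := by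
  change MvPolynomial.eval₂Hom (RingHom.id ℂ) _ (MvPolynomial.bind₁ _ P) = MvPolynomial.eval₂Hom (RingHom.id ℂ) _ P
  rw [MvPolynomial.eval₂Hom_bind₁]
  refine congrArg (fun φ : ((Fin 2 ⊕ Fin 2) × (Fin 2 ⊕ Fin 2)) ⊕ ((Fin 2 ⊕ Fin 2) × (Fin 2 ⊕ Fin 2)) → ℂ =>
    (MvPolynomial.eval₂Hom (RingHom.id ℂ) φ) P) (funext fun i => ?_)
  rcases i with ⟨p, q⟩ | ⟨p, q⟩
  · simp only [Sum.elim_inl, map_sum, map_mul, MvPolynomial.eval₂Hom_X', MvPolynomial.eval₂Hom_C, RingHom.id_apply, Matrix.mul_apply]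
  · simp only [Sum.elim_inr, map_sum, map_mul, MvPolynomial.eval₂Hom_X', MvPolynomial.eval₂Hom_C, RingHom.id_apply, Matrix.mul_apply]

/-- a substitution by polynomials of total degree `≤ 1` does not raise the total degree. [folklore] -/
theorem totalDegree_bind₁_le_of_le_one {σ τ : Type*} {f : σ → MvPolynomial τ ℂ} (hf : ∀ i, (f i).totalDegree ≤ 1) (P : MvPolynomial σ ℂ) :
    (MvPolynomial.bind₁ f P).totalDegree ≤ P.totalDegree := by
  classical
  conv_lhs => rw [P.as_sum]
  rw [map_sum]
  refine MvPolynomial.totalDegree_finsetSum_le fun d hd => ?_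
  rw [MvPolynomial.bind₁_monomial]
  refine (MvPolynomial.totalDegree_mul _ _).trans ?_
  rw [MvPolynomial.totalDegree_C, zero_add]
  refine (MvPolynomial.totalDegree_finsetProd _ _).trans ?_
  refine le_trans (Finset.sum_le_sum fun i _ => (MvPolynomial.totalDegree_pow _ _).trans (Nat.mul_le_mul_left _ (hf i))) ?_
  simp only [mul_one]
  exact MvPolynomial.le_totalDegree hd

/-- the translation substitution has total degree `≤ 1` in every variable. [folklore] -/
theorem totalDegree_translateSubst_le_one (k₀ : Matrix (Fin 2 ⊕ Fin 2) (Fin 2 ⊕ Fin 2) ℂ)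
    (i : ((Fin 2 ⊕ Fin 2) × (Fin 2 ⊕ Fin 2)) ⊕ ((Fin 2 ⊕ Fin 2) × (Fin 2 ⊕ Fin 2))) :
    (Sum.elim (fun pq : (Fin 2 ⊕ Fin 2) × (Fin 2 ⊕ Fin 2) =>
        ∑ r, (MvPolynomial.X (Sum.inl (pq.1, r)) : MvPolynomial (((Fin 2 ⊕ Fin 2) × (Fin 2 ⊕ Fin 2)) ⊕ ((Fin 2 ⊕ Fin 2) × (Fin 2 ⊕ Fin 2))) ℂ) *
          MvPolynomial.C (k₀ r pq.2))
      (fun pq : (Fin 2 ⊕ Fin 2) × (Fin 2 ⊕ Fin 2) => ∑ r, MvPolynomial.X (Sum.inr (pq.1, r)) * MvPolynomial.C (conj (k₀ r pq.2))) i).totalDegree ≤ 1 := by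
  rcases i with ⟨p, q⟩ | ⟨p, q⟩
  · simp only [Sum.elim_inl]
    refine MvPolynomial.totalDegree_finsetSum_le fun r _ => (MvPolynomial.totalDegree_mul _ _).trans ?_
    rw [MvPolynomial.totalDegree_X, MvPolynomial.totalDegree_C]
  · simp only [Sum.elim_inr]
    refine MvPolynomial.totalDegree_finsetSum_le fun r _ => (MvPolynomial.totalDegree_mul _ _).trans ?_
    rw [MvPolynomial.totalDegree_X, MvPolynomial.totalDegree_C]

/-- **all right translates of one polynomial picture have total degree `≤ deg P`.** [folklore] -/
theorem totalDegree_bind₁_translate_le (P : MvPolynomial (((Fin 2 ⊕ Fin 2) × (Fin 2 ⊕ Fin 2)) ⊕ ((Fin 2 ⊕ Fin 2) × (Fin 2 ⊕ Fin 2))) ℂ)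
    (k₀ : Matrix (Fin 2 ⊕ Fin 2) (Fin 2 ⊕ Fin 2) ℂ) :
    (MvPolynomial.bind₁
        (Sum.elim (fun pq : (Fin 2 ⊕ Fin 2) × (Fin 2 ⊕ Fin 2) => ∑ r, MvPolynomial.X (Sum.inl (pq.1, r)) * MvPolynomial.C (k₀ r pq.2))
          (fun pq : (Fin 2 ⊕ Fin 2) × (Fin 2 ⊕ Fin 2) => ∑ r, MvPolynomial.X (Sum.inr (pq.1, r)) * MvPolynomial.C (conj (k₀ r pq.2)))) P).totalDegree ≤ P.totalDegree :=
  totalDegree_bind₁_le_of_le_one (totalDegree_translateSubst_le_one k₀) P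

/-- **the translate picture depends continuously on `k₀`**: `k₀ ↦ eval_{u·k₀} P` is continuous (a polynomial in the entries of `k₀`). [folklore] -/
theorem continuous_eval_translate (P : MvPolynomial (((Fin 2 ⊕ Fin 2) × (Fin 2 ⊕ Fin 2)) ⊕ ((Fin 2 ⊕ Fin 2) × (Fin 2 ⊕ Fin 2))) ℂ)
    (u : Matrix (Fin 2 ⊕ Fin 2) (Fin 2 ⊕ Fin 2) ℂ) :
    Continuous fun k₀ : Matrix (Fin 2 ⊕ Fin 2) (Fin 2 ⊕ Fin 2) ℂ =>
      MvPolynomial.eval (Sum.elim (fun pq : (Fin 2 ⊕ Fin 2) × (Fin 2 ⊕ Fin 2) => (u * k₀) pq.1 pq.2) (fun pq : (Fin 2 ⊕ Fin 2) × (Fin 2 ⊕ Fin 2) => conj ((u * k₀) pq.1 pq.2))) P := by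
  have hmul : Continuous fun k₀ : Matrix (Fin 2 ⊕ Fin 2) (Fin 2 ⊕ Fin 2) ℂ => u * k₀ := continuous_const.matrix_mul continuous_id
  have hev : Continuous fun k₀ : Matrix (Fin 2 ⊕ Fin 2) (Fin 2 ⊕ Fin 2) ℂ =>
      (Sum.elim (fun pq : (Fin 2 ⊕ Fin 2) × (Fin 2 ⊕ Fin 2) => (u * k₀) pq.1 pq.2) (fun pq : (Fin 2 ⊕ Fin 2) × (Fin 2 ⊕ Fin 2) => conj ((u * k₀) pq.1 pq.2)) :
        ((Fin 2 ⊕ Fin 2) × (Fin 2 ⊕ Fin 2)) ⊕ ((Fin 2 ⊕ Fin 2) × (Fin 2 ⊕ Fin 2)) → ℂ) := by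
    refine continuous_pi fun i => ?_
    rcases i with ⟨p, q⟩ | ⟨p, q⟩
    · simp only [Sum.elim_inl]; exact hmul.matrix_elem p q
    · simp only [Sum.elim_inr]; exact Complex.continuous_conj.comp (hmul.matrix_elem p q)
  exact (MvPolynomial.continuous_eval P).comp hev

/-! ## §4 Unitary bookkeeping for the Levi ambiguity `R ↦ R′·κ` -/

/-- a `2 × 2` unitary has `‖det‖ = 1`. [folklore] -/
theorem norm_det_of_unitary {κ : Matrix (Fin 2) (Fin 2) ℂ} (hκ : κᴴ * κ = 1) : ‖κ.det‖ = 1 := by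
  have h := congrArg Matrix.det hκ
  rw [det_mul, det_conjTranspose, det_one, star_def] at h
  have h2 : ‖κ.det‖ ^ 2 = 1 := by
    have := congrArg (fun z : ℂ => ‖z‖) h
    simpa only [norm_mul, norm_conj, norm_one, ← sq] using this
  nlinarith [norm_nonneg κ.det, h2]

/-- entries of a `2 × 2` unitary and of its adjoint are `≤ 1`. [folklore] -/
theorem norm_apply_le_one_of_unitary {κ : Matrix (Fin 2) (Fin 2) ℂ} (hκ : κᴴ * κ = 1) (i j : Fin 2) : ‖κ i j‖ ≤ 1 ∧ ‖κᴴ i j‖ ≤ 1 := by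
  have hmem : κ ∈ Matrix.unitaryGroup (Fin 2) ℂ := Matrix.mem_unitaryGroup_iff'.2 (by rwa [star_eq_conjTranspose])
  refine ⟨entry_norm_bound_of_unitary hmem i j, ?_⟩
  rw [conjTranspose_apply, star_def, norm_conj]
  exact entry_norm_bound_of_unitary hmem j i

/-- **the entrywise sum `T₂` under unitary conjugation**: `T₂(κᴴ·M·κ) ≤ 4·T₂(M)` (★ `entrySum_mul_mul_le`). [folklore] -/
theorem entrySum_unitary_conj_le (M : Matrix (Fin 2) (Fin 2) ℂ) {κ : Matrix (Fin 2) (Fin 2) ℂ} (hκ : κᴴ * κ = 1) :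
    ∑ a, ∑ b, ‖(κᴴ * M * κ) a b‖ ≤ 4 * ∑ a, ∑ b, ‖M a b‖ := by
  have h := entrySum_mul_mul_le (P := κᴴ) (X := M) (Q := κ) (fun i j => (norm_apply_le_one_of_unitary hκ i j).2)
    (fun i j => (norm_apply_le_one_of_unitary hκ i j).1)
  simpa only [mul_one] using h

/-- `‖det(κᴴ·M·κ)‖ = ‖det M‖` for unitary `κ`. [folklore] -/
theorem norm_det_unitary_conj (M : Matrix (Fin 2) (Fin 2) ℂ) {κ : Matrix (Fin 2) (Fin 2) ℂ} (hκ : κᴴ * κ = 1) :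
    ‖(κᴴ * M * κ).det‖ = ‖M.det‖ := by
  have h1 := norm_det_of_unitary hκ
  have h2 : ‖κᴴ.det‖ = 1 := by rw [det_conjTranspose, star_def, norm_conj, h1]
  rw [det_mul, det_mul, norm_mul, norm_mul, h1, h2, one_mul, mul_one]

/-! ## §5 The family merge: finitely many parameter-dependent letters, one set of constants -/

/-- **UNIFORM GROWTH OF A FINITELY GENERATED FAMILY, PARAMETERS THREADED.**  `EwG i p` (`i : ι` finite) are letters depending on admissible parameters `p`
(`adm p`; face data `δ p, T p, D p ≥ 0`), each with (ii″)-shaped growth near every `z` with constants UNIFORM in `p`.  THEN for every coefficient vector `a`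
with `Σ_i ‖a i‖ ≤ Ma` the combination `Σ_i a i · EwG i p` has (ii″)-shaped growth near every `z` with ONE set of constants, uniform in `(a, p)`:
`Cg := Ma·2·Σ Cg_i`, `cg := (1 + Σ cg_i⁻¹)⁻¹`, `N := Σ N_i`, `N′ := Σ N′_i`, `r := (1 + Σ r_i⁻¹)⁻¹` (★ `face_mono`).  (★ K2E4-p10's `growth_uniform_of_finite_span`
with the parameter inside the letters and the linear relation definitional.) [cite: Shimura1997, §18.4] [cite: KudlaRallis1994, §1] -/
theorem exists_uniform_of_finite_family {ι P : Type*} [Fintype ι] (adm : P → Prop) (δ T D : P → ℝ)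
    (hδ : ∀ p, adm p → 0 ≤ δ p) (hT : ∀ p, adm p → 0 ≤ T p) (hD : ∀ p, adm p → 0 ≤ D p)
    (EwG : ι → P → ℂ → ℂ)
    (hgrowth : ∀ (i : ι) (z : ℂ), 0 < z.re → ∃ Cg cg N N' r : ℝ, 0 ≤ Cg ∧ 0 < cg ∧ 0 ≤ N ∧ 0 ≤ N' ∧ 0 < r ∧
      ∀ s : ℂ, dist s z < r → ∀ p, adm p →
        ‖EwG i p s‖ ≤ Cg * δ p ^ (2 - 2 * s.re) * Real.exp (-(cg * T p)) * (1 + T p) ^ N * (1 + D p ^ (-N')))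
    {Ma : ℝ} (hMa : 0 ≤ Ma) :
    ∀ z : ℂ, 0 < z.re → ∃ Cg cg N N' r : ℝ, 0 ≤ Cg ∧ 0 < cg ∧ 0 ≤ N ∧ 0 ≤ N' ∧ 0 < r ∧
      ∀ a : ι → ℂ, ∑ i, ‖a i‖ ≤ Ma → ∀ s : ℂ, dist s z < r → ∀ p, adm p →
        ‖∑ i, a i * EwG i p s‖ ≤ Cg * δ p ^ (2 - 2 * s.re) * Real.exp (-(cg * T p)) * (1 + T p) ^ N * (1 + D p ^ (-N')) := by
  intro z hz
  choose Cg cg N N' r hCg hcg hN hN' hr hB using fun i => hgrowth i z hz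
  have hSC : 0 ≤ ∑ i, Cg i := Finset.sum_nonneg fun i _ => hCg i
  have hci : ∀ i, 0 ≤ (cg i)⁻¹ := fun i => (inv_pos.2 (hcg i)).le
  have hri : ∀ i, 0 ≤ (r i)⁻¹ := fun i => (inv_pos.2 (hr i)).le
  have hc1 : 0 < 1 + ∑ i, (cg i)⁻¹ := by linarith [Finset.sum_nonneg fun i (_ : i ∈ Finset.univ) => hci i]
  have hr1 : 0 < 1 + ∑ i, (r i)⁻¹ := by linarith [Finset.sum_nonneg fun i (_ : i ∈ Finset.univ) => hri i]
  refine ⟨Ma * (2 * ∑ i, Cg i), (1 + ∑ i, (cg i)⁻¹)⁻¹, ∑ i, N i, ∑ i, N' i, (1 + ∑ i, (r i)⁻¹)⁻¹,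
    mul_nonneg hMa (by positivity), inv_pos.2 hc1, Finset.sum_nonneg fun i _ => hN i, Finset.sum_nonneg fun i _ => hN' i, inv_pos.2 hr1,
    fun a ha s hs p hp => ?_⟩
  set Φ : ℝ := δ p ^ (2 - 2 * s.re) * Real.exp (-((1 + ∑ i, (cg i)⁻¹)⁻¹ * T p)) * (1 + T p) ^ (∑ i, N i) * (1 + D p ^ (-∑ i, N' i)) with hΦ
  have hA : 0 ≤ δ p ^ (2 - 2 * s.re) := Real.rpow_nonneg (hδ p hp) _
  have hΦ0 : 0 ≤ Φ := mul_nonneg (mul_nonneg (mul_nonneg hA (Real.exp_pos _).le) (Real.rpow_nonneg (by linarith [hT p hp]) _))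
    (by have := Real.rpow_nonneg (hD p hp) (-∑ i, N' i); linarith)
  -- each letter under the merged face
  have hbasis : ∀ i, ‖EwG i p s‖ ≤ (2 * ∑ j, Cg j) * Φ := by
    intro i
    have hsi : dist s z < r i := lt_of_lt_of_le hs (inv_one_add_sum_le hri (hr i) i le_rfl)
    refine (hB i s hsi p hp).trans ?_
    have hm := face_mono (A := δ p ^ (2 - 2 * s.re)) (T := T p) (D := D p) (hCg i)
      (by linarith [le_sum_univ hCg i] : 2 * Cg i ≤ 2 * ∑ j, Cg j) (inv_one_add_sum_le hci (hcg i) i le_rfl)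
      (le_sum_univ hN i) (hN' i) (le_sum_univ hN' i) hA (hT p hp) (hD p hp)
    rw [hΦ]
    calc Cg i * δ p ^ (2 - 2 * s.re) * Real.exp (-(cg i * T p)) * (1 + T p) ^ N i * (1 + D p ^ (-N' i))
        ≤ (2 * ∑ j, Cg j) * δ p ^ (2 - 2 * s.re) * Real.exp (-((1 + ∑ j, (cg j)⁻¹)⁻¹ * T p)) * (1 + T p) ^ (∑ j, N j) *
            (1 + D p ^ (-∑ j, N' j)) := hm
      _ = _ := by ring
  -- sum up with the coefficient bound
  calc ‖∑ i, a i * EwG i p s‖ ≤ ∑ i, ‖a i * EwG i p s‖ := norm_sum_le _ _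
    _ ≤ ∑ i, ‖a i‖ * ((2 * ∑ j, Cg j) * Φ) := Finset.sum_le_sum fun i _ => by
        rw [norm_mul]; exact mul_le_mul_of_nonneg_left (hbasis i) (norm_nonneg _)
    _ = (∑ i, ‖a i‖) * ((2 * ∑ j, Cg j) * Φ) := by rw [Finset.sum_mul]
    _ ≤ Ma * ((2 * ∑ j, Cg j) * Φ) := mul_le_mul_of_nonneg_right ha (mul_nonneg (by positivity) hΦ0)
    _ = Ma * (2 * ∑ i, Cg i) * δ p ^ (2 - 2 * s.re) * Real.exp (-((1 + ∑ i, (cg i)⁻¹)⁻¹ * T p)) * (1 + T p) ^ (∑ i, N i) *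
          (1 + D p ^ (-∑ i, N' i)) := by rw [hΦ]; ring

end Summit.HodgeConjecture.HodgeConjecture.Cruxes.HLiu418.K2LiuKindWArchStabPictures

end
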